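import Summits.QuantumFields.QCD.Theses.EulerDescent
import Literature.MathematicalPhysics.QuantumFieldTheory.QCDPhysicalBranch

/-!
# The MASSIVE RAY ABOVE (stub U of line `bounded_locator` rev 3, crux `EulerDescent.HonestHeavyAnchor`,
# item stmt-QuantumFields-16901) FROM the Literature ray certificate `QCDRegularisation.OnPhysicalBranch`
# at a DEGENERATE renormalised mass tuple

Worker file (def-free, sorry-free, standard axioms) for the registered stub `stub_uniformlyMassiveAboveOfBody` (U) of
`Cruxes/HonestHeavyAnchor/Lines/bounded_locator.lean`: "for `N_f ∈ {2,3}`, every mass-scaling, asymptotically scaling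
regularisation `reg` carrying the heavy QCD body above `M` admits `M'` such that, eventually in `k`, EVERY degenerate bare
Wilson mass `μ ≥ m_crit(k) + a_k M'/Z_m(k)` is massive at `β_k` — one onset `k₀` for all `μ` on the ray and all pairs
`(A, B)` of gauge-invariant local lattice observables".  The stub is open-problem grade and is NOT proved here (its
`μ = +∞` end is volume-uniform clustering of lattice `SU(3)` Yang–Mills at FIXED weak `β_k`; landed end point:
`HonestHeavyAnchorQuenchedLimit.tendsto_qcdLatticeConnectedCorr_gluonic_atTop`).

## What is landed: the adapter to the Literature currency `OnPhysicalBranch` / `QCDUniformClustering`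

`QCDRegularisation.OnPhysicalBranch reg m` (`QCDPhysicalBranch.lean`) says: eventually in `k`, for every `t ≥ 0` there is
ONE lattice rate `δ > 0` with `QCDUniformClustering (β_k) (m_f(k) + t) δ` — clustering of ALL pairs at the common rate
`δ`.  At the DEGENERATE tuple `m = (M', …, M')` the shifted trajectory `m_f(k) + t`, `t ≥ 0`, sweeps exactly the ray of
degenerate bare masses `μ ≥ m_crit(k) + a_k M'/Z_m(k)` (§1, a ring identity over `QCDRegularisation.scheme_mq`), so

* §2 `onPhysicalBranch_const_iff`: `reg.OnPhysicalBranch (fun _ => M')` ⟺ eventually in `k`, every degenerate `μ` on the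
  ray clusters volume-uniformly at SOME COMMON rate `δ(k, μ) > 0` (`∃ δ, ∀ A B`);
* §2 `massiveRay_of_onPhysicalBranch` (a): hence `reg.OnPhysicalBranch (fun _ => M')` implies U's conclusion for `reg, M'`
  (which asks only `∀ A B, ∃ δ`: the rate may depend on the pair);
* §3 `stub_uniformlyMassiveAboveOfBody_of_physicalBranchOfBody` (b): the statement-level reduction — "every body-carrying
  regularisation is on the physical branch at some degenerate tuple" implies the registered stub VERBATIM.

## The gap, recorded honestly (c)

(b)'s hypothesis is STRONGER than U: U's conclusion is the per-pair form `∀ A B, ∃ C δ S₀` of the ray certificate, whereas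
`OnPhysicalBranch` demands a rate uniform over all pairs (`∃ δ, ∀ A B, ∃ C S₀`).  The converse "U ⇒ (b)'s hypothesis" would
need an `inf` over pairs of the per-pair rates to stay positive — on a transfer-matrix lattice theory both are the gap
above the vacuum, but that spectral reading (Lüscher's positive transfer matrix, Montvay–Münster §1.5.2 (1.199)–(1.201)) is
not in the tree, and here nothing is claimed.  `massiveRay_of_uniformRay` is the only direction that is pure logic.

## Named nearest items (bookkeeping for the lead; none implies U)

* `QuarkMassMonotone.ChirallyAnchoredQCDTwo` (stmt-QuantumFields-17306) / `ChirallyAnchoredQCDThree` (stmt-17305) carry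
  the ray certificate — by `QCDRegularisation.onPhysicalBranch_iff` (`Iff.rfl`) literally `reg.OnPhysicalBranch m⋆` —
  but (i) for ONE existentially given regularisation (U is universal over body-carrying `reg`), and (ii) at anchors
  `m⋆` with `0 < m⋆_f ≤ m_f` below each positive tuple `m`, which the formal text does NOT require to be degenerate (the
  docstring's "equivalently … degenerate tuples `(η_j, η_j, η_j)`" is the informal converse; the `def` has a bare
  `∃ mstar`), so the certified rays `m⋆(k) + t` may all lie OFF the diagonal and give not even U's conclusion on the
  degenerate axis of that one `reg`.  §4 records exactly what they give: `∃ reg, … ∀ m > 0, ∃ m⋆ ≤ m, reg.OnPhysicalBranch m⋆`.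
* `GluonFreeDual.AllCouplingClustering` (stmt-9713, route closed): uniform-rate clustering at every `β ≥ 0` and all
  POSITIVE bare masses — it would give U's conclusion on the part `μ > 0` of the ray (eventually `β_k ≥ 0` by asymptotic
  scaling), but the ray's foot `m_crit(k) + a_k M'/Z_m(k)` is expected NEGATIVE for every fixed `M'` eventually
  (`κ_c(β) > 1/8`, i.e. `m_crit(k) < 0` bounded away from `0` at the couplings met, while `a_k/Z_m(k) → 0`), and U's
  hypotheses do not constrain the sign of `m_crit` — so it does not reach the ray.
* `HeavyThresholdYMBridge.HeavyLatticeGapFromYM` (stmt-8795) / `YMLatticeGapAlongAFSequences` (8796) / 8778: conclusions of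
  the shape `∀ A B, ∃ C, ∀ᶠ k` (`QCDScheme.HasLatticeMassGap` along ONE trajectory), i.e. per pair and per mass tuple its
  own onset — the quantifier gap that U is about; they do not give U.

## Presearch (corpus), recorded for the lead

`lit search --hybrid "hopping parameter expansion convergence uniform in volume lattice QCD heavy quarks arbitrary
coupling"` → Montvay–Münster 1994 §5.1.3 pp. 230–232 (hopping expansion of `Tr log(1 − K M[U])` and of the propagator:
convergent for `|K|` small CONFIGURATION-WISE, used numerically on quenched backgrounds — no volume-uniform clustering
theorem of the coupled system at weak `β`); `lit vsearch "exponential clustering … heavy Wilson fermions at weak coupling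
uniformly in the volume"` → Montvay–Münster pp. 160–161 (§3.6.2 strong-coupling cluster expansion of PURE gauge glueball
correlators), Creutz, Rebbi (numerics); `lit galaxy search "hopping parameter expansion"` (substring mode; the semantic
back-ends timed out, rc 0 with "queued too long") → 8 numerical/finite-density papers, none a theorem.  Verdict: no printed
theorem gives fixed-`β` volume-uniform clustering of lattice QCD beyond the corner "small `β` AND small `κ`"
(Osterwalder–Seiler, Ann. Phys. 110 (1978) 440; Montvay–Münster §3.7.1; Meyer-Ortmanns–Reisz 2006 §4.1.3, §4.1.5).
-/

namespace Summit.QuantumFields.QCD.Theorems.HonestHeavyAnchorMassiveRay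

open Filter Topology
open Literature.MathematicalPhysics.QuantumFieldTheory

variable {Nf : ℕ}

/-! ## §1 The shifted degenerate trajectory is the degenerate ray -/

/-- The bare trajectory of the degenerate tuple `(M', …, M')` is flavour-blind: `m_f(k) = m_crit(k) + a_k M'/Z_m(k)` for
every flavour `f` (unfolding `QCDRegularisation.scheme_mq`). [folklore] -/
theorem scheme_mq_const (reg : QCDRegularisation Nf) (M' : ℝ) (z shift : QCDField Nf → ℕ → ℝ) (f : Fin Nf) (k : ℕ) :
    (reg.scheme (fun _ => M') z shift).mq f k = reg.mcrit k + reg.a k * M' / reg.Zm k := rfl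

/-- Shifting the degenerate trajectory by `t` gives the degenerate bare tuple `(m_crit(k) + a_k M'/Z_m(k) + t, …)`. [folklore] -/
theorem scheme_mq_const_add (reg : QCDRegularisation Nf) (M' t : ℝ) (k : ℕ) :
    (fun f : Fin Nf => (reg.scheme (fun _ => M') 0 0).mq f k + t) =
      fun _ : Fin Nf => reg.mcrit k + reg.a k * M' / reg.Zm k + t := rfl

/-- Shifting the degenerate trajectory by `t := μ − (m_crit(k) + a_k M'/Z_m(k))` lands exactly on the degenerate bare
tuple `(μ, …, μ)` (ring identity). [folklore] -/
theorem scheme_mq_const_add_sub (reg : QCDRegularisation Nf) (M' μ : ℝ) (k : ℕ) :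
    (fun f : Fin Nf => (reg.scheme (fun _ => M') 0 0).mq f k + (μ - (reg.mcrit k + reg.a k * M' / reg.Zm k))) =
      fun _ : Fin Nf => μ := by
  funext f
  rw [QCDRegularisation.scheme_mq]
  ring

/-! ## §2 `OnPhysicalBranch` at a degenerate tuple, in the currency of the stub -/

/-- **The ray certificate at the degenerate tuple `(M', …, M')`, unfolded onto the degenerate axis**:
`reg.OnPhysicalBranch (fun _ => M')` holds iff, eventually in `k`, lattice QCD at `β_k` clusters volume-uniformly at SOME
common lattice rate `δ > 0` (one rate for all pairs of observables) at EVERY degenerate bare mass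
`μ ≥ m_crit(k) + a_k M'/Z_m(k)` — the substitution `t = μ − (m_crit(k) + a_k M'/Z_m(k)) ≥ 0`. [folklore] -/
theorem onPhysicalBranch_const_iff (reg : QCDRegularisation Nf) (M' : ℝ) :
    reg.OnPhysicalBranch (fun _ => M') ↔
      ∀ᶠ k in atTop, ∀ μ : ℝ, reg.mcrit k + reg.a k * M' / reg.Zm k ≤ μ →
        ∃ δ : ℝ, 0 < δ ∧ QCDUniformClustering (reg.β k) (fun _ : Fin Nf => μ) δ := by
  constructor
  · intro h
    filter_upwards [h] with k hk μ hμ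
    obtain ⟨δ, hδ, hcl⟩ := hk (μ - (reg.mcrit k + reg.a k * M' / reg.Zm k)) (sub_nonneg.2 hμ)
    rw [scheme_mq_const_add_sub] at hcl
    exact ⟨δ, hδ, hcl⟩
  · intro h
    filter_upwards [h] with k hk t ht
    obtain ⟨δ, hδ, hcl⟩ := hk (reg.mcrit k + reg.a k * M' / reg.Zm k + t) (le_add_of_nonneg_right ht)
    rw [scheme_mq_const_add]
    exact ⟨δ, hδ, hcl⟩

/-- **A uniformly-rated massive ray is a massive ray** (pure logic: `∃ δ, ∀ A B, ∃ C S₀` implies `∀ A B, ∃ C δ S₀`): if,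
eventually in `k`, every degenerate bare mass on the ray above `m_crit(k) + a_k M'/Z_m(k)` clusters volume-uniformly at some
common rate, then U's conclusion holds for `reg, M'`. [folklore] -/
theorem massiveRay_of_uniformRay (reg : QCDRegularisation Nf) (M' : ℝ)
    (h : ∀ᶠ k in atTop, ∀ μ : ℝ, reg.mcrit k + reg.a k * M' / reg.Zm k ≤ μ →
      ∃ δ : ℝ, 0 < δ ∧ QCDUniformClustering (reg.β k) (fun _ : Fin Nf => μ) δ) :
    ∀ᶠ k in atTop, ∀ μ : ℝ, reg.mcrit k + reg.a k * M' / reg.Zm k ≤ μ →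
      ∀ (R R' : ℕ) (A : QCDLatticeObservable Nf R) (B : QCDLatticeObservable Nf R'), ∃ (C δ : ℝ) (S₀ : ℕ),
        0 < δ ∧ ∀ S : ℕ, S₀ ≤ S → ∀ n : ℕ, n ≤ S →
          ‖qcdLatticeConnectedCorr (reg.β k) (2 * S + 1) (fun _ : Fin Nf => μ) A B n‖ ≤ C * Real.exp (-(δ * n)) := by
  filter_upwards [h] with k hk μ hμ R R' A B
  obtain ⟨δ, hδ, hcl⟩ := hk μ hμ
  obtain ⟨C, S₀, hC⟩ := hcl R R' A B
  exact ⟨C, δ, S₀, hδ, hC⟩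

/-- **(a) The massive ray above from the physical-branch certificate at a degenerate tuple**: if `reg` is on the physical
branch at `(M', …, M')` (`QCDRegularisation.OnPhysicalBranch`), then, eventually in `k`, EVERY degenerate bare Wilson mass
`μ ≥ m_crit(k) + a_k M'/Z_m(k)` is massive at `β_k` — every pair of gauge-invariant local lattice QCD observables clusters
at a positive lattice rate uniformly in the torus, with ONE onset `k₀` for all such `μ` and all pairs: U's conclusion for
`reg, M'` (in fact with the rate uniform over pairs, which U does not ask). [folklore] -/
theorem massiveRay_of_onPhysicalBranch (reg : QCDRegularisation Nf) (M' : ℝ) (h : reg.OnPhysicalBranch (fun _ => M')) :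
    ∀ᶠ k in atTop, ∀ μ : ℝ, reg.mcrit k + reg.a k * M' / reg.Zm k ≤ μ →
      ∀ (R R' : ℕ) (A : QCDLatticeObservable Nf R) (B : QCDLatticeObservable Nf R'), ∃ (C δ : ℝ) (S₀ : ℕ),
        0 < δ ∧ ∀ S : ℕ, S₀ ≤ S → ∀ n : ℕ, n ≤ S →
          ‖qcdLatticeConnectedCorr (reg.β k) (2 * S + 1) (fun _ : Fin Nf => μ) A B n‖ ≤ C * Real.exp (-(δ * n)) :=
  massiveRay_of_uniformRay reg M' ((onPhysicalBranch_const_iff reg M').1 h)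

/-- The certificate at ANY degenerate tuple `(M₁, …, M₁)` gives the massive ray above every HIGHER foot `M' ≥ M₁` (upward
closure `OnPhysicalBranch.add_const` with `c = M' − M₁ ≥ 0`, then (a)). [folklore] -/
theorem massiveRay_of_onPhysicalBranch_of_le (reg : QCDRegularisation Nf) {M₁ M' : ℝ}
    (h : reg.OnPhysicalBranch (fun _ => M₁)) (hle : M₁ ≤ M') :
    ∀ᶠ k in atTop, ∀ μ : ℝ, reg.mcrit k + reg.a k * M' / reg.Zm k ≤ μ →
      ∀ (R R' : ℕ) (A : QCDLatticeObservable Nf R) (B : QCDLatticeObservable Nf R'), ∃ (C δ : ℝ) (S₀ : ℕ),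
        0 < δ ∧ ∀ S : ℕ, S₀ ≤ S → ∀ n : ℕ, n ≤ S →
          ‖qcdLatticeConnectedCorr (reg.β k) (2 * S + 1) (fun _ : Fin Nf => μ) A B n‖ ≤ C * Real.exp (-(δ * n)) := by
  have h' : reg.OnPhysicalBranch (fun _ => M₁ + (M' - M₁)) := h.add_const (sub_nonneg.2 hle)
  have heq : (fun _ : Fin Nf => M₁ + (M' - M₁)) = fun _ => M' := by
    funext f
    ring
  rw [heq] at h'
  exact massiveRay_of_onPhysicalBranch reg M' h'

/-! ## §3 (b) The statement-level reduction: the registered stub VERBATIM from "body ⇒ physical branch at a degenerate tuple" -/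

/-- **(b) `stub_uniformlyMassiveAboveOfBody` from the physical branch of body-carrying regularisations.**  If for
`N_f ∈ {2,3}` every mass-scaling, asymptotically scaling regularisation carrying the heavy QCD body above `M` is on the
physical branch (`QCDRegularisation.OnPhysicalBranch`) at SOME degenerate renormalised tuple `(M', …, M')`, then the
registered stub U of line `bounded_locator` holds VERBATIM (consequent copied from the skeleton).  The hypothesis is
STRONGER than U (common rate over all pairs at each `(k, μ)`; U asks a per-pair rate) and is itself open-problem grade:
fixed-weak-`β_k` volume-uniform clustering of Wilson lattice QCD with heavy degenerate quarks, uniformly up the mass ray.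
[folklore] -/
theorem stub_uniformlyMassiveAboveOfBody_of_physicalBranchOfBody :
    (∀ Nf : ℕ, Nf = 2 ∨ Nf = 3 → ∀ (reg : QCDRegularisation Nf) (M : ℝ), reg.HasMassScaling →
      (reg.scheme 0 0 0).HasAsymptoticScaling →
      (∀ m : Fin Nf → ℝ, (∀ f, M < m f) → ∃ (z shift : QCDField Nf → ℕ → ℝ) (T : OSData (QCDField Nf) 4),
        IsQCDAlong (reg.scheme m z shift) T ∧ T.IsNontrivial QCDField.glue ∧ T.IsNonGaussian QCDField.glue ∧
          (∀ f g : Fin Nf, f ≠ g → T.IsNontrivial (QCDField.pseudoRe f g)) ∧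
            ∃ Δ > 0, T.HasMassGap Δ ∧ (reg.scheme m z shift).HasLatticeMassGap Δ) →
      ∃ M' : ℝ, reg.OnPhysicalBranch (fun _ => M')) →
    ∀ Nf : ℕ, Nf = 2 ∨ Nf = 3 → ∀ (reg : QCDRegularisation Nf) (M : ℝ), reg.HasMassScaling →
    (reg.scheme 0 0 0).HasAsymptoticScaling →
    (∀ m : Fin Nf → ℝ, (∀ f, M < m f) → ∃ (z shift : QCDField Nf → ℕ → ℝ) (T : OSData (QCDField Nf) 4),
    IsQCDAlong (reg.scheme m z shift) T ∧ T.IsNontrivial QCDField.glue ∧ T.IsNonGaussian QCDField.glue ∧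
    (∀ f g : Fin Nf, f ≠ g → T.IsNontrivial (QCDField.pseudoRe f g)) ∧
    ∃ Δ > 0, T.HasMassGap Δ ∧ (reg.scheme m z shift).HasLatticeMassGap Δ) →
    ∃ M' : ℝ, ∀ᶠ k in atTop, ∀ μ : ℝ, reg.mcrit k + reg.a k * M' / reg.Zm k ≤ μ →
    ∀ (R R' : ℕ) (A : QCDLatticeObservable Nf R) (B : QCDLatticeObservable Nf R'), ∃ (C δ : ℝ) (S₀ : ℕ),
    0 < δ ∧ ∀ S : ℕ, S₀ ≤ S → ∀ n : ℕ, n ≤ S →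
    ‖qcdLatticeConnectedCorr (reg.β k) (2 * S + 1) (fun _ : Fin Nf => μ) A B n‖ ≤ C * Real.exp (-(δ * n)) := by
  intro h Nf hNf reg M hms haf hbody
  obtain ⟨M', hM'⟩ := h Nf hNf reg M hms haf hbody
  exact ⟨M', massiveRay_of_onPhysicalBranch reg M' hM'⟩

/-- **(b') the same reduction with the uniformly-rated ray as hypothesis** (the `OnPhysicalBranch`-free phrasing of (b),
equivalent to it by `onPhysicalBranch_const_iff`): "every body-carrying regularisation admits `M'` such that eventually every
degenerate `μ ≥ m_crit(k) + a_k M'/Z_m(k)` clusters volume-uniformly at a common positive rate" implies U verbatim. [folklore] -/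
theorem stub_uniformlyMassiveAboveOfBody_of_uniformRayOfBody :
    (∀ Nf : ℕ, Nf = 2 ∨ Nf = 3 → ∀ (reg : QCDRegularisation Nf) (M : ℝ), reg.HasMassScaling →
      (reg.scheme 0 0 0).HasAsymptoticScaling →
      (∀ m : Fin Nf → ℝ, (∀ f, M < m f) → ∃ (z shift : QCDField Nf → ℕ → ℝ) (T : OSData (QCDField Nf) 4),
        IsQCDAlong (reg.scheme m z shift) T ∧ T.IsNontrivial QCDField.glue ∧ T.IsNonGaussian QCDField.glue ∧
          (∀ f g : Fin Nf, f ≠ g → T.IsNontrivial (QCDField.pseudoRe f g)) ∧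
            ∃ Δ > 0, T.HasMassGap Δ ∧ (reg.scheme m z shift).HasLatticeMassGap Δ) →
      ∃ M' : ℝ, ∀ᶠ k in atTop, ∀ μ : ℝ, reg.mcrit k + reg.a k * M' / reg.Zm k ≤ μ →
        ∃ δ : ℝ, 0 < δ ∧ QCDUniformClustering (reg.β k) (fun _ : Fin Nf => μ) δ) →
    ∀ Nf : ℕ, Nf = 2 ∨ Nf = 3 → ∀ (reg : QCDRegularisation Nf) (M : ℝ), reg.HasMassScaling →
    (reg.scheme 0 0 0).HasAsymptoticScaling →
    (∀ m : Fin Nf → ℝ, (∀ f, M < m f) → ∃ (z shift : QCDField Nf → ℕ → ℝ) (T : OSData (QCDField Nf) 4),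
    IsQCDAlong (reg.scheme m z shift) T ∧ T.IsNontrivial QCDField.glue ∧ T.IsNonGaussian QCDField.glue ∧
    (∀ f g : Fin Nf, f ≠ g → T.IsNontrivial (QCDField.pseudoRe f g)) ∧
    ∃ Δ > 0, T.HasMassGap Δ ∧ (reg.scheme m z shift).HasLatticeMassGap Δ) →
    ∃ M' : ℝ, ∀ᶠ k in atTop, ∀ μ : ℝ, reg.mcrit k + reg.a k * M' / reg.Zm k ≤ μ →
    ∀ (R R' : ℕ) (A : QCDLatticeObservable Nf R) (B : QCDLatticeObservable Nf R'), ∃ (C δ : ℝ) (S₀ : ℕ),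
    0 < δ ∧ ∀ S : ℕ, S₀ ≤ S → ∀ n : ℕ, n ≤ S →
    ‖qcdLatticeConnectedCorr (reg.β k) (2 * S + 1) (fun _ : Fin Nf => μ) A B n‖ ≤ C * Real.exp (-(δ * n)) := by
  intro h Nf hNf reg M hms haf hbody
  obtain ⟨M', hM'⟩ := h Nf hNf reg M hms haf hbody
  exact ⟨M', massiveRay_of_uniformRay reg M' hM'⟩

/-! ## §4 What the nearest named items give (bookkeeping): `OnPhysicalBranch` at anchors of ONE regularisation -/

/-- **`ChirallyAnchoredQCDTwo` (stmt-QuantumFields-17306) gives the ray certificate only at its own anchors**: one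
regularisation `reg : QCDRegularisation 2` and, below every positive tuple `m`, an anchor `m⋆` (`0 < m⋆_f ≤ m_f`, NOT
required degenerate) with `reg.OnPhysicalBranch m⋆` (`onPhysicalBranch_iff` is `Iff.rfl`).  This is neither U (universal over
body-carrying regularisations) nor U's conclusion on the degenerate axis of this `reg` (the rays `m⋆(k) + t` may lie off the
diagonal). [folklore] -/
theorem onPhysicalBranch_anchors_of_chirallyAnchoredQCDTwo
    (h : Summit.QuantumFields.QCD.Theses.QuarkMassMonotone.ChirallyAnchoredQCDTwo) :
    ∃ reg : QCDRegularisation 2, reg.HasMassScaling ∧ reg.IsChiralAtZero ∧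
      ∀ m : Fin 2 → ℝ, (∀ f, 0 < m f) → ∃ mstar : Fin 2 → ℝ, (∀ f, 0 < mstar f ∧ mstar f ≤ m f) ∧
        reg.OnPhysicalBranch mstar ∧ ∃ Δ : ℝ, 0 < Δ ∧ (reg.scheme mstar 0 0).HasLatticeMassGap Δ := by
  obtain ⟨reg, hms, hch, hanch, -⟩ := h
  refine ⟨reg, hms, hch, fun m hm => ?_⟩
  obtain ⟨mstar, hle, hray, hgap⟩ := hanch m hm
  exact ⟨mstar, hle, (reg.onPhysicalBranch_iff mstar).2 hray, hgap⟩

/-- **`ChirallyAnchoredQCDThree` (stmt-QuantumFields-17305) gives the ray certificate only at its own anchors** (the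
`N_f = 3` twin of `onPhysicalBranch_anchors_of_chirallyAnchoredQCDTwo`). [folklore] -/
theorem onPhysicalBranch_anchors_of_chirallyAnchoredQCDThree
    (h : Summit.QuantumFields.QCD.Theses.QuarkMassMonotone.ChirallyAnchoredQCDThree) :
    ∃ reg : QCDRegularisation 3, reg.HasMassScaling ∧ reg.IsChiralAtZero ∧
      ∀ m : Fin 3 → ℝ, (∀ f, 0 < m f) → ∃ mstar : Fin 3 → ℝ, (∀ f, 0 < mstar f ∧ mstar f ≤ m f) ∧
        reg.OnPhysicalBranch mstar ∧ ∃ Δ : ℝ, 0 < Δ ∧ (reg.scheme mstar 0 0).HasLatticeMassGap Δ := by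
  obtain ⟨reg, hms, hch, hanch, -⟩ := h
  refine ⟨reg, hms, hch, fun m hm => ?_⟩
  obtain ⟨mstar, hle, hray, hgap⟩ := hanch m hm
  exact ⟨mstar, hle, (reg.onPhysicalBranch_iff mstar).2 hray, hgap⟩

end Summit.QuantumFields.QCD.Theorems.HonestHeavyAnchorMassiveRay
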